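import Summits.QuantumFields.GaugeBoot.TiltedBoxEvenMidAxisGeometry
import Summits.QuantumFields.GaugeBoot.DiagonalRPTorusNontrivialRep
import HarnessLib

/-!
# The witness against in-plane LINK reflection positivity on the even square tilted box (gauge-boot, L3 negative supplement; twisted-slab mechanism, the test function)

HONEST FRAMING (cell `pub-gaugeboot`, page 1 of every file): the venture produces certified bounds
on lattice expectations at stated coupling, gauge group, dimension and torus size; NOT a mass gap,
NOT a continuum limit, NOT a string tension; NOT Yang–Mills-summit-bearing (barriers
`FixedCouplingUltralocality`, `PerturbativeInvisibility`). This is the test function of the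
NEGATIVE result `TiltedBoxEvenMidAxisRPNegative.lean`.

On the square tilted box of even side `M = 2P` with the link mirror `Θ` along `i`
(`configMidReflect e i σ`, `σ = Θ_i`; on classes `x_i ↦ 1 - x_i`, `TiltedBoxEvenMidAxisGeometry.lean`)
the half observable refuting reflection positivity is the one of the odd box
(`TiltedBoxOddAxisWitness.lean`), placed in the layer `x_i ≡ P` below the twisted slab at `P + ½`:

  `F(U) = (W_p(U) - W_{p+T}(U)) · exp(β ∑_q c_q (N - Re tr ρ(U_q)))`,

`p = (y₀; a, b)` a transverse plaquette of the layer `x_i ≡ P` (`y₀ = [P e_i] = layerSite`,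
`a, b ≠ i`), `T = [2P e_j]` the twist, `c_q ∈ {0, 1}` the half-space weights `midWeight`
(`1` iff all links of `q` lie in the closed half `{1 ≤ x_i ≤ P}`). New on the even side: the
exact slab at `½` is NOT cancelled by `F` — its Boltzmann factor
`B(U) = ∏_{q slab at ½} exp(-β (N - Re tr ρ(U_q)))` (`midLower`, continuous, POSITIVE, a function
of the layers `0`, `1` and the crossing links at `½`, all OFF the block of the layer `P + 1` when
`P ≥ 2`) survives and rides along as a frozen positive factor. This file proves:

* `midDiff = W_p - W_{p+T}`, `midExpo = ∑_q c_q (N - Re tr ρ(U_q))`, `midLower = B`, `midF`;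
  continuity/boundedness/positivity; **`isMidObservable_midF`** (`F` depends only on links with
  both endpoints in `{1 ≤ x_i ≤ P}`, the shape of `tiltedBox_linkRP`);
* **`midExpo_configMidReflect_add`** — the cancellation of the Boltzmann weight:
  `E(ΘU) + E(U) - S(U) = -∑_{q ∈ slab(0) ∪ slab(P)} (N - Re tr ρ(U_q))`
  (`midWeight_add_midWeight_plaqMidReflect` summed over the involution `plaqMidReflect`);
* **`midDiff_configMidReflect`** — `(W_p - W_{p+T})(ΘU) = W_{p↑+T}(U) - W_{p↑}(U)`, `p↑ = p + e_i`
  (the twist lemma `θ y₀ = y₀ + T + e_i`, `θ(y₀ + T) = y₀ + e_i`);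
* `dependsOn_midLower` (off the block of the layer `P + 1`, `P ≥ 2`) and
  **`integral_midLower_mul_midDiff_sq_pos`** — `0 < ∫ B · (W_p - W_{p+T})² dμ₀`.

Everything is `[folklore]` bookkeeping.

References: J. Fröhlich, R. Israel, E. H. Lieb, B. Simon, J. Stat. Phys. 22 (1980) 297, §3;
K. Osterwalder, E. Seiler, Ann. Phys. 110 (1978) 440, §2.
-/

noncomputable section

open MeasureTheory QuotientAddGroup
open Literature.MathematicalPhysics.QuantumFieldTheory (haarProbability)
open Literature.RepresentationTheory.CompactGroups

namespace Summit.QuantumFields.GaugeBoot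

namespace TiltedRP

open IsSiteFrame (plaqReflect plaqReflect_fst_of_not_hasDir plaqReflect_snd)

section Witness

variable {d : ℕ} {i j : Fin d} {L P N : ℕ} [NeZero L] [NeZero P]
variable {G : Type*} [Group G]

/-! ## The layer site and the twist -/

omit [NeZero L] [NeZero P] in
/-- `x_i(y₀) = P` for `y₀ = [P e_i]` (`layerSite`), read through `axisCoord`. [folklore] -/
theorem axisCoord_layerSite :
    axisCoord d L (2 * P) (layerSite d L P : TiltedSite d i j (2 * P) (2 * P) L) = ((P : ℕ) : ZMod (2 * P)) := by
  rw [layerSite, axisCoord_mk, Pi.single_eq_same, Int.cast_natCast]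

omit [NeZero L] [NeZero P] in
/-- `x_i(y₀ + T) = P`. [folklore] -/
theorem axisCoord_layerSite_add_twist (hij : i ≠ j) :
    axisCoord d L (2 * P) ((layerSite d L P : TiltedSite d i j (2 * P) (2 * P) L) + tiltedTwist d L (2 * P)) =
      ((P : ℕ) : ZMod (2 * P)) := by
  rw [map_add, axisCoord_layerSite, axisCoord_tiltedTwist d L _ hij, add_zero]

/-! ## The observables -/

variable (ρ : G →* Matrix (Fin N) (Fin N) ℂ) (q : DirPair d)

/-- The difference `W_{y₀} - W_{y₀ + T}` of the observables of the transverse plaquette `q` based at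
`y₀ = [P e_i]` and at its twist translate. [folklore] -/
def midDiff (U : Config (TiltedSite d i j (2 * P) (2 * P) L) d G) : ℝ :=
  plaqObs ρ (tiltedUnit d i j (2 * P) (2 * P) L) (layerSite d L P, q) U -
    plaqObs ρ (tiltedUnit d i j (2 * P) (2 * P) L) (layerSite d L P + tiltedTwist d L (2 * P), q) U

/-- The half-weighted action `E(U) = ∑_q c_q (N - Re tr ρ(U_q))` of the link mirror. [folklore] -/
def midExpo (U : Config (TiltedSite d i j (2 * P) (2 * P) L) d G) : ℝ :=
  ∑ p : Plaq (TiltedSite d i j (2 * P) (2 * P) L) d,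
    midWeight p * ((N : ℝ) - plaqObs ρ (tiltedUnit d i j (2 * P) (2 * P) L) p U)

/-- **The Boltzmann factor of the exact slab at `½`**:
`B(U) = ∏_{q slab above the layer 0} exp(-β (N - Re tr ρ(U_q)))`. [folklore] -/
def midLower (β : ℝ) (U : Config (TiltedSite d i j (2 * P) (2 * P) L) d G) : ℝ :=
  ∏ p ∈ Finset.univ.filter (SquareSlab.IsSlabPlaq (0 : ZMod (2 * P))),
    Real.exp (-(β * ((N : ℝ) - plaqObs ρ (tiltedUnit d i j (2 * P) (2 * P) L) p U)))

/-- **The witness** `F = (W_{y₀} - W_{y₀+T}) · exp(β E)`. [folklore] -/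
def midF (β : ℝ) (U : Config (TiltedSite d i j (2 * P) (2 * P) L) d G) : ℂ :=
  ((midDiff ρ q U : ℝ) : ℂ) * ((Real.exp (β * midExpo ρ U) : ℝ) : ℂ)

section Regularity

variable [TopologicalSpace G] [IsTopologicalGroup G]

omit [NeZero L] [NeZero P] in
/-- `midDiff` is continuous. [folklore] -/
theorem continuous_midDiff (hρ : Continuous ρ) :
    Continuous fun U : Config (TiltedSite d i j (2 * P) (2 * P) L) d G => midDiff ρ q U :=
  (continuous_plaqObs ρ hρ _ _).sub (continuous_plaqObs ρ hρ _ _)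

/-- `E` is continuous. [folklore] -/
theorem continuous_midExpo (hρ : Continuous ρ) :
    Continuous fun U : Config (TiltedSite d i j (2 * P) (2 * P) L) d G => midExpo ρ U :=
  continuous_finsetSum _ fun p _ => continuous_const.mul (continuous_const.sub (continuous_plaqObs ρ hρ _ p))

/-- `B` is continuous. [folklore] -/
theorem continuous_midLower (hρ : Continuous ρ) (β : ℝ) :
    Continuous fun U : Config (TiltedSite d i j (2 * P) (2 * P) L) d G => midLower ρ β U :=
  continuous_finsetProd _ fun p _ =>
    Real.continuous_exp.comp ((continuous_const.mul (continuous_const.sub (continuous_plaqObs ρ hρ _ p))).neg)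

omit [TopologicalSpace G] [IsTopologicalGroup G] in
/-- `B > 0`. [folklore] -/
theorem midLower_pos (β : ℝ) (U : Config (TiltedSite d i j (2 * P) (2 * P) L) d G) : 0 < midLower ρ β U :=
  Finset.prod_pos fun _ _ => Real.exp_pos _

/-- `F` is continuous. [folklore] -/
theorem continuous_midF (hρ : Continuous ρ) (β : ℝ) :
    Continuous fun U : Config (TiltedSite d i j (2 * P) (2 * P) L) d G => midF ρ q β U :=
  (Complex.continuous_ofReal.comp (continuous_midDiff ρ q hρ)).mul
    (Complex.continuous_ofReal.comp (Real.continuous_exp.comp (continuous_const.mul (continuous_midExpo ρ hρ))))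

/-- `F` is bounded (continuous on the compact configuration space). [folklore] -/
theorem exists_norm_midF_le [CompactSpace G] (hρ : Continuous ρ) (β : ℝ) :
    ∃ C : ℝ, ∀ U : Config (TiltedSite d i j (2 * P) (2 * P) L) d G, ‖midF ρ q β U‖ ≤ C := by
  obtain ⟨C, hC⟩ := isBounded_iff_forall_norm_le.1
    (isCompact_range (continuous_midF (i := i) (j := j) (L := L) (P := P) ρ q hρ β)).isBounded
  exact ⟨C, fun U => hC _ ⟨U, rfl⟩⟩

end Regularity

/-! ## The witness is a half observable of `{1 ≤ x_i ≤ P}` -/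

omit [NeZero L] [NeZero P] in
/-- Plaquette observables agree on configurations agreeing on the positive links, for plaquettes of
non-zero weight. [folklore] -/
theorem plaqObs_eq_of_midWeight_ne_zero (hP : 2 ≤ P) {U V : Config (TiltedSite d i j (2 * P) (2 * P) L) d G}
    (hUV : ∀ l, IsMidPosLink (tiltedUnit d i j (2 * P) (2 * P) L) P (axisCoord d L (2 * P)) l → U l = V l)
    {p : Plaq (TiltedSite d i j (2 * P) (2 * P) L) d} (hp : midWeight p ≠ 0) :
    plaqObs ρ (tiltedUnit d i j (2 * P) (2 * P) L) p U = plaqObs ρ (tiltedUnit d i j (2 * P) (2 * P) L) p V := by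
  obtain ⟨h1, h2, h3, h4⟩ := isMidPosLink_of_midWeight_ne_zero hP hp
  unfold plaqObs
  rw [holonomy_congr _ p.1 p.2.1.1 p.2.1.2 (hUV _ h1) (hUV _ h2) (hUV _ h3) (hUV _ h4)]

/-- **The witness is an observable of the closed half `{1 ≤ x_i ≤ P}`** (`IsMidObservable`, the
hypothesis shape of `tiltedBox_linkRP`). [folklore] -/
theorem isMidObservable_midF (hP : 2 ≤ P) (hij : i ≠ j) (hq1 : q.1.1 ≠ i) (hq2 : q.1.2 ≠ i) (β : ℝ) :
    IsMidObservable (tiltedUnit d i j (2 * P) (2 * P) L) P (axisCoord d L (2 * P)) (fun U => midF ρ q β U) := by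
  intro U V hUV
  have hW : ∀ x, axisCoord d L (2 * P) x = ((P : ℕ) : ZMod (2 * P)) →
      plaqObs ρ (tiltedUnit d i j (2 * P) (2 * P) L) (x, q) U = plaqObs ρ (tiltedUnit d i j (2 * P) (2 * P) L) (x, q) V := by
    intro x hx
    exact plaqObs_eq_of_midWeight_ne_zero ρ hP hUV (by rw [midWeight_transverse hP q x hq1 hq2 hx]; norm_num)
  have hD : midDiff ρ q U = midDiff ρ q V := by
    unfold midDiff
    rw [hW _ axisCoord_layerSite, hW _ (axisCoord_layerSite_add_twist hij)]
  have hE : midExpo ρ U = midExpo ρ V := by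
    unfold midExpo
    refine Finset.sum_congr rfl fun p _ => ?_
    by_cases hp : midWeight p = 0
    · rw [hp, zero_mul, zero_mul]
    · rw [plaqObs_eq_of_midWeight_ne_zero ρ hP hUV hp]
  show midF ρ q β U = midF ρ q β V
  unfold midF
  rw [hD, hE]

/-! ## The cancellation of the Boltzmann weight -/

/-- **`E(ΘU) + E(U) - S(U) = -∑_{slab(0) ∪ slab(P)} (N - Re tr ρ(U_q))`**: the half-weighted actions
of `U` and of its mirror image cover every plaquette exactly once, except the plaquettes of the two
slabs, which are covered by neither. [folklore] -/
theorem midExpo_configMidReflect_add [TopologicalSpace G] [IsTopologicalGroup G] [CompactSpace G]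
    (hP : 2 ≤ P) (hij : i ≠ j) (hρ : Continuous ρ) (U : Config (TiltedSite d i j (2 * P) (2 * P) L) d G) :
    midExpo ρ (configMidReflect (tiltedUnit d i j (2 * P) (2 * P) L) i (tiltedAxisFlip d L (2 * P) hij) U) +
      midExpo ρ U - wilsonAction ρ (tiltedUnit d i j (2 * P) (2 * P) L) U =
      -∑ p ∈ Finset.univ.filter (fun p => SquareSlab.IsSlabPlaq (0 : ZMod (2 * P)) p ∨
          SquareSlab.IsSlabPlaq ((P : ℕ) : ZMod (2 * P)) p),
        ((N : ℝ) - plaqObs ρ (tiltedUnit d i j (2 * P) (2 * P) L) p U) := by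
  have hF : IsAxisFlip (tiltedUnit d i j (2 * P) (2 * P) L) i (tiltedAxisFlip d L (2 * P) hij) :=
    isAxisFlip_tiltedAxisFlip d L (2 * P) hij
  -- reindex `E(ΘU)` along the involution `plaqMidReflect`
  have h1 : midExpo ρ (configMidReflect (tiltedUnit d i j (2 * P) (2 * P) L) i (tiltedAxisFlip d L (2 * P) hij) U) =
      ∑ p : Plaq (TiltedSite d i j (2 * P) (2 * P) L) d,
        midWeight (plaqMidReflect (tiltedUnit d i j (2 * P) (2 * P) L) i (tiltedAxisFlip d L (2 * P) hij) p) *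
          ((N : ℝ) - plaqObs ρ (tiltedUnit d i j (2 * P) (2 * P) L) p U) := by
    unfold midExpo
    have h := hF.sum_plaqMidReflect_configMidReflect ρ hρ
      (fun p => midWeight (plaqMidReflect (tiltedUnit d i j (2 * P) (2 * P) L) i (tiltedAxisFlip d L (2 * P) hij) p))
      (fun r => (N : ℝ) - r) U
    simp only [hF.plaqMidReflect_plaqMidReflect] at h
    exact h
  rw [h1, midExpo, wilsonAction, ← Finset.sum_add_distrib, ← Finset.sum_sub_distrib, ← Finset.sum_neg_distrib,
    Finset.sum_filter]
  refine Finset.sum_congr rfl fun p _ => ?_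
  have h2 := midWeight_add_midWeight_plaqMidReflect hP hij p
  by_cases hs : SquareSlab.IsSlabPlaq (0 : ZMod (2 * P)) p ∨ SquareSlab.IsSlabPlaq ((P : ℕ) : ZMod (2 * P)) p
  · rw [if_pos hs] at h2; rw [if_pos hs]
    linear_combination ((N : ℝ) - plaqObs ρ (tiltedUnit d i j (2 * P) (2 * P) L) p U) * h2
  · rw [if_neg hs] at h2; rw [if_neg hs]
    linear_combination ((N : ℝ) - plaqObs ρ (tiltedUnit d i j (2 * P) (2 * P) L) p U) * h2

/-! ## The reflected difference -/

omit [NeZero L] [NeZero P] in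
/-- **`(W_{y₀} - W_{y₀+T})(ΘU) = W_{y₀+T+e_i}(U) - W_{y₀+e_i}(U)`** (the twist lemma: the layer `P` is
carried onto the layer `P + 1` translated by `T`). [folklore] -/
theorem midDiff_configMidReflect [TopologicalSpace G] [IsTopologicalGroup G] [CompactSpace G]
    (hij : i ≠ j) (hq1 : q.1.1 ≠ i) (hq2 : q.1.2 ≠ i) (hρ : Continuous ρ)
    (U : Config (TiltedSite d i j (2 * P) (2 * P) L) d G) :
    midDiff ρ q (configMidReflect (tiltedUnit d i j (2 * P) (2 * P) L) i (tiltedAxisFlip d L (2 * P) hij) U) =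
      plaqObs ρ (tiltedUnit d i j (2 * P) (2 * P) L)
          (layerSite d L P + tiltedTwist d L (2 * P) + tiltedUnit d i j (2 * P) (2 * P) L i, q) U -
        plaqObs ρ (tiltedUnit d i j (2 * P) (2 * P) L) (layerSite d L P + tiltedUnit d i j (2 * P) (2 * P) L i, q) U := by
  have hF : IsAxisFlip (tiltedUnit d i j (2 * P) (2 * P) L) i (tiltedAxisFlip d L (2 * P) hij) :=
    isAxisFlip_tiltedAxisFlip d L (2 * P) hij
  have hnot : ∀ x : TiltedSite d i j (2 * P) (2 * P) L,
      ¬ HasDir ((x, q) : Plaq (TiltedSite d i j (2 * P) (2 * P) L) d) i := fun x h => h.elim hq1 hq2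
  have hW : ∀ x : TiltedSite d i j (2 * P) (2 * P) L,
      plaqObs ρ (tiltedUnit d i j (2 * P) (2 * P) L) (x, q)
          (configMidReflect (tiltedUnit d i j (2 * P) (2 * P) L) i (tiltedAxisFlip d L (2 * P) hij) U) =
        plaqObs ρ (tiltedUnit d i j (2 * P) (2 * P) L)
          (midReflect (tiltedUnit d i j (2 * P) (2 * P) L) i (tiltedAxisFlip d L (2 * P) hij) x, q) U := by
    intro x
    rw [configMidReflect_eq_configReflect_translate, hF.plaqObs_configReflect ρ hρ, plaqObs_translate,
      ← plaqMidReflect_eq_plaqReflect_add,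
      show plaqMidReflect (tiltedUnit d i j (2 * P) (2 * P) L) i (tiltedAxisFlip d L (2 * P) hij) (x, q) =
        (midReflect (tiltedUnit d i j (2 * P) (2 * P) L) i (tiltedAxisFlip d L (2 * P) hij) x, q) from
        Prod.ext (plaqMidReflect_fst_of_not_hasDir (hnot x)) (plaqMidReflect_snd _)]
  unfold midDiff
  rw [hW, hW, midReflect_of_axisCoord_eq_half d L P hij _ axisCoord_layerSite,
    midReflect_of_axisCoord_eq_half d L P hij _ (axisCoord_layerSite_add_twist hij),
    add_assoc (layerSite d L P) (tiltedTwist d L (2 * P)) (tiltedTwist d L (2 * P)),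
    tiltedTwist_add_tiltedTwist d L _ hij, add_zero]

/-! ## The exact slab lives off the block of the layer `P + 1` -/

/-- A link based in a layer other than `a + 1` is not in the block above `a`. [folklore] -/
theorem not_mem_block_of_axisCoord_ne {M : ℕ} [NeZero M] {a : ZMod M} {x : TiltedSite d i j M M L}
    (hx : axisCoord d L M x ≠ a + 1) (m : Fin d) : (x, m) ∉ SquareSlab.block d i j L M a :=
  fun h => hx (SquareSlab.mem_block.1 h).1

/-- **`B` depends only on links off the block of the layer `P + 1`** (`P ≥ 2`: the plaquettes of the
slab at `½` have their links in the layers `0`, `1` and among the `i`-links). [folklore] -/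
theorem dependsOn_midLower [DecidableEq (TiltedSite d i j (2 * P) (2 * P) L)] (hP : 2 ≤ P) (β : ℝ) :
    DependsOn (fun U : Config (TiltedSite d i j (2 * P) (2 * P) L) d G => midLower ρ β U)
      (((SquareSlab.block d i j L (2 * P) ((P : ℕ) : ZMod (2 * P)))ᶜ : Finset _) : Set _) := by
  intro U V hUV
  have hPval := val_natCast_self hP
  have h1val := val_one_eq hP
  -- the layers `0` and `1` are not the layer `P + 1`
  have hval1 : (((P : ℕ) : ZMod (2 * P)) + 1).val = P + 1 := by
    rw [val_add_one hP, hPval, if_neg (by omega)]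
  have hne0 : (0 : ZMod (2 * P)) ≠ ((P : ℕ) : ZMod (2 * P)) + 1 := fun h => by
    have h' := congrArg ZMod.val h
    rw [ZMod.val_zero, hval1] at h'
    omega
  have hne1 : (1 : ZMod (2 * P)) ≠ ((P : ℕ) : ZMod (2 * P)) + 1 := fun h => by
    have h' := congrArg ZMod.val h
    rw [h1val, hval1] at h'
    omega
  dsimp only
  unfold midLower
  refine Finset.prod_congr rfl fun p hp => ?_
  rw [Finset.mem_filter] at hp
  obtain ⟨-, hdir, hlay⟩ := hp
  have hlay' : ∀ m, m ≠ i → axisCoord d L (2 * P) (p.1 + tiltedUnit d i j (2 * P) (2 * P) L m) = 0 := fun m hm => by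
    rw [axisCoord_add_tiltedUnit, if_neg hm, add_zero, hlay]
  have hup : ∀ x : TiltedSite d i j (2 * P) (2 * P) L, axisCoord d L (2 * P) x = 0 →
      axisCoord d L (2 * P) (x + tiltedUnit d i j (2 * P) (2 * P) L i) = 1 := fun x hx => by
    rw [axisCoord_add_tiltedUnit, if_pos rfl, hx, zero_add]
  -- every link of `p` is off the block: either an `i`-link or based in the layer `0` or `1`
  have hoff : ∀ (x : TiltedSite d i j (2 * P) (2 * P) L) (m : Fin d),
      (m = i ∨ axisCoord d L (2 * P) x = 0 ∨ axisCoord d L (2 * P) x = 1) →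
      U (x, m) = V (x, m) := by
    intro x m hm
    refine hUV _ ?_
    simp only [Finset.coe_compl, Set.mem_compl_iff, Finset.mem_coe]
    rcases hm with hm | hm | hm
    · subst hm; exact SquareSlab.not_mem_block_of_dir _ _
    · exact not_mem_block_of_axisCoord_ne (by rw [hm]; exact hne0) m
    · exact not_mem_block_of_axisCoord_ne (by rw [hm]; exact hne1) m
  have hW : plaqObs ρ (tiltedUnit d i j (2 * P) (2 * P) L) p U = plaqObs ρ (tiltedUnit d i j (2 * P) (2 * P) L) p V := by
    unfold plaqObs
    rcases hdir with hk | hl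
    · -- directions `(i, m)`
      rw [holonomy_congr _ p.1 p.2.1.1 p.2.1.2 (hoff _ _ (Or.inl hk))
        (by rw [hk]; exact hoff _ _ (Or.inr (Or.inr (hup _ hlay)))) (hoff _ _ (Or.inl hk))
        (hoff _ _ (Or.inr (Or.inl hlay)))]
    · -- directions `(m, i)`
      rw [holonomy_congr _ p.1 p.2.1.1 p.2.1.2 (hoff _ _ (Or.inr (Or.inl hlay))) (hoff _ _ (Or.inl hl))
        (by rw [hl]; exact hoff _ _ (Or.inr (Or.inr (hup _ hlay)))) (hoff _ _ (Or.inl hl))]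
  rw [hW]

/-! ## The difference is not negligible -/

variable [TopologicalSpace G] [IsTopologicalGroup G] [CompactSpace G] [MeasurableSpace G] [BorelSpace G]
  [SecondCountableTopology G]

/-- **`0 < ∫ B · (W_{y₀} - W_{y₀+T})² dμ₀`** for the product Haar measure: `B > 0`, the difference is
continuous and non-zero at the configuration with a single non-trivial link on `(y₀, a)` (this link
belongs to `p` but not to `p + T`: `T ≠ 0`, `T + e_b ≠ 0`), and the product Haar measure charges
open sets. Needs `ρ` non-trivial. [folklore] -/
theorem integral_midLower_mul_midDiff_sq_pos [DecidableEq (TiltedSite d i j (2 * P) (2 * P) L)]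
    (hij : i ≠ j) (hq2 : q.1.2 ≠ i)
    (he2 : tiltedUnit d i j (2 * P) (2 * P) L q.1.2 ≠ 0) (hρ : Continuous ρ) (hρ1 : ∃ g, ρ g ≠ 1) (β : ℝ) :
    0 < ∫ U, midLower ρ β U * midDiff ρ q U ^ 2 ∂(productHaar (TiltedSite d i j (2 * P) (2 * P) L) d G) := by
  have hP0 : P ≠ 0 := NeZero.ne P
  haveI := isProbabilityMeasure_productHaar (A := TiltedSite d i j (2 * P) (2 * P) L) (d := d) (G := G)
  haveI : IsProbabilityMeasure (haarProbability G) := CompactGroup.isProbabilityMeasure_haarMeasure_top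
  haveI : (haarProbability G).IsOpenPosMeasure := by unfold haarProbability; infer_instance
  haveI : (productHaar (TiltedSite d i j (2 * P) (2 * P) L) d G).IsOpenPosMeasure := by
    unfold productHaar; infer_instance
  obtain ⟨g₀, hg₀⟩ := (DiagRPTwo.exists_re_trace_ne_iff ρ hρ).2 hρ1
  have hab : q.1.1 ≠ q.1.2 := ne_of_lt q.2
  set y₀ : TiltedSite d i j (2 * P) (2 * P) L := layerSite d L P with hy₀
  -- the special configuration: `g₀` on the link `(y₀, a)`, `1` elsewhere
  have hW1 : plaqObs ρ (tiltedUnit d i j (2 * P) (2 * P) L) (y₀, q) (Function.update 1 (y₀, q.1.1) g₀) =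
      ((ρ g₀).trace).re := by
    unfold plaqObs holonomy
    have h2 : (y₀ + tiltedUnit d i j (2 * P) (2 * P) L q.1.1, q.1.2) ≠ (y₀, q.1.1) := fun h => hab (congrArg Prod.snd h).symm
    have h3 : (y₀ + tiltedUnit d i j (2 * P) (2 * P) L q.1.2, q.1.1) ≠ (y₀, q.1.1) := fun h => he2 (by
      have := congrArg Prod.fst h; simpa using this)
    have h4 : (y₀, q.1.2) ≠ (y₀, q.1.1) := fun h => hab (congrArg Prod.snd h).symm
    simp only [Function.update_self, Function.update_of_ne h2, Function.update_of_ne h3,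
      Function.update_of_ne h4, Pi.one_apply, mul_one, inv_one]
  have hW2 : plaqObs ρ (tiltedUnit d i j (2 * P) (2 * P) L) (y₀ + tiltedTwist d L (2 * P), q)
      (Function.update 1 (y₀, q.1.1) g₀) = N := by
    unfold plaqObs holonomy
    have h1 : (y₀ + tiltedTwist d L (2 * P), q.1.1) ≠ (y₀, q.1.1) := fun h =>
      SquareBox.tiltedTwist_ne_zero (L := L) (M := 2 * P) hij (by have := congrArg Prod.fst h; simpa using this)
    have h2 : (y₀ + tiltedTwist d L (2 * P) + tiltedUnit d i j (2 * P) (2 * P) L q.1.1, q.1.2) ≠ (y₀, q.1.1) :=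
      fun h => hab (congrArg Prod.snd h).symm
    have h3 : (y₀ + tiltedTwist d L (2 * P) + tiltedUnit d i j (2 * P) (2 * P) L q.1.2, q.1.1) ≠ (y₀, q.1.1) := fun h =>
      SquareBox.tiltedTwist_add_unit_ne_zero (L := L) (M := 2 * P) (by omega) hij hq2 (by
        have := congrArg Prod.fst h; rw [add_assoc] at this; simpa using this)
    have h4 : (y₀ + tiltedTwist d L (2 * P), q.1.2) ≠ (y₀, q.1.1) := fun h => hab (congrArg Prod.snd h).symm
    simp only [Function.update_of_ne h1, Function.update_of_ne h2, Function.update_of_ne h3,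
      Function.update_of_ne h4, Pi.one_apply, mul_one, inv_one, map_one, Matrix.trace_one, Fintype.card_fin,
      Complex.natCast_re]
  have hne : midDiff ρ q (Function.update 1 (y₀, q.1.1) g₀) ≠ 0 := by
    unfold midDiff; rw [← hy₀, hW1, hW2]; exact sub_ne_zero.2 hg₀
  -- positivity on the open set where the difference is non-zero
  have hcont := continuous_midDiff (i := i) (j := j) (L := L) (P := P) ρ q hρ
  have hcontB := continuous_midLower (i := i) (j := j) (L := L) (P := P) ρ hρ β
  have hint : Integrable (fun U => midLower ρ β U * midDiff ρ q U ^ 2)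
      (productHaar (TiltedSite d i j (2 * P) (2 * P) L) d G) :=
    (hcontB.mul (hcont.pow 2)).integrable_of_hasCompactSupport (HasCompactSupport.of_compactSpace _)
  rw [integral_pos_iff_support_of_nonneg (fun U => mul_nonneg (midLower_pos ρ β U).le (sq_nonneg _)) hint]
  have hopen : IsOpen {U : Config (TiltedSite d i j (2 * P) (2 * P) L) d G | midDiff ρ q U ≠ 0} :=
    isOpen_ne_fun hcont continuous_const
  refine lt_of_lt_of_le (hopen.measure_pos _ ⟨_, hne⟩) (measure_mono fun U hU => ?_)
  rw [Function.mem_support]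
  exact mul_ne_zero (midLower_pos ρ β U).ne' (pow_ne_zero 2 hU)

end Witness

end TiltedRP

end Summit.QuantumFields.GaugeBoot

end
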